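import Summits.NavierStokesRegularity.FluidComputer.ClayBreakdownWitnessViscosity
import Literature.Analysis.FluidPDE.FluidComputerGadgetRobust
import Literature.Analysis.FluidPDE.ClassicalSolutionRescale
import Literature.Analysis.FluidPDE.ClassicalSolutionGlue
import Literature.Analysis.FluidPDE.TaoForcedUniquenessSchwartzForce

/-!
# Fluid computer, door N1-FC — the ONE-SHOT TRIGGERED TRANSFER scheme, typed (forced Clay class (C))

Cell `ns-blowup`, seat `ns-blowup-fc-route` (D-0074 GROUP C «bridge support»; LADDER-NS rung N1-FC
«forced fluid computer»). LABEL: E–C typing. WHAT THIS IS NOT: not Navier–Stokes evidence and not a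
construction — three TYPES/predicates and two one-line lemmas about a constant; no instance of any
scheme is claimed anywhere; the DNS decision cell PREREG-FC-TRIG-1 (pub-fluidc, `λ = 2`, floor
`μ = λη ≥ 1`) measures a MODEL analogue of `TriggerScheme.Step` and is never an item.

**The door.** A Clay-class force — smooth on `[0,∞) × ℝ³` with Fefferman's decay (5) — has bounded
derivatives of every order, so it cannot itself feed the fine scales of a cascade; what it CAN do is
plant, level after level, a super-polynomially small SEED (the "trigger") at a time of our choosing
(the "clock"). The fluid must then perform, by its own nonlinear instability, a ONE-SHOT transfer of
its level energy to the next scale `λ⁻¹`, with efficiency `η` (child / parent energy) above the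
Kelvin-critical floor `η > 1/λ` (`η > m/λ` with `m` children per parent — the FC-AUDIT floor),
UNIFORMLY in the level Reynolds number: the bookkeeping `E_{k+1} = η E_k`,
`Re_{k+1} = (ηλ)^{1/2} Re_k` must climb, because the seeds shrink super-polynomially (smoothness of
the summed force THROUGH the blow-up time), so the number of e-folds the instability needs grows
without bound, and only a growing Reynolds number supplies them within the viscous lifetime
(`TriggerScheme.Transfers`: an amplitude `ε` is admissible iff `ν |log ε| ≤ a U`).

**Unit scale.** By the exact symmetries of the system — parabolic scaling at fixed viscosity, space
and time translation (`IsClassicalNSSolutionOn.nsRescale_translate`, `.comp_add_right`) — one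
level is every level, so the scheme is typed AT UNIT SCALE and indexed by the velocity amplitude
`U` of the level state (= its Reynolds number at unit viscosity): `TriggerScheme` = the designed
family `F U` of unit-scale level states (Clay data, speed floor `c U` in the nest ball `B̄(0,R)`,
a seed) with its constants; `TriggerScheme.IsTrigger ε δ T g` = an admissible trigger of amplitude
`ε` (smooth on all of `ℝ × ℝ³`, zero for `t ≤ δ` and for `t ≥ T`, zero outside the nest ball,
`‖Dⁱ g‖ ≤ ε A_i` for every `i`); `TriggerScheme.Step ν U ε w` = ONE triggered transfer: an exact
classical solution of the system forced by such a trigger, from `w`, on `[0, T + δ]` with finite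
energy, hand-over time `T ≤ C_τ (1 + |log ε|)^q / U` (poly-logarithmically many turnovers), whose
hand-over state `u T` is EXACTLY the `λ`-zoom `x ↦ λ • w' (λ • (x - x₀))`, `‖x₀‖ ≤ D`, of a member
`w'` of the family at amplitude `U' ≥ (ηλ)^{1/2} U`; `TriggerScheme.Transfers ν` = the step is
available from every member at every amplitude `U ≥ U⋆` for every admissible `ε ∈ (0, 1]`.

The route `Theses/TriggeredTransferDoor.lean` carries `∃ 𝒮, 𝒮.Transfers 1` (the physics: open,
never asserted) and `∀ 𝒮, 𝒮.Transfers 1 → (forced Cor. 11.4) → Nonempty (BreakdownWitness 1)`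
(the analysis: countable gluing along unforced overlaps by uniqueness —
`IsClassicalNSSolutionOn.glue` — with the seeds `ε_n = max (exp (-a U_n)) (λ^{-n²})`, admissible
and, since `U_n ≥ (ηλ)^{n/2} U_0` climbs geometrically, small enough after the level-`n` zoom
(factor `λ^{n(3+2i)}` on `Dⁱ`) for the summed force to be smooth through `T* = Σ_n λ^{-2n}(T_n+…)`),
and closes on Fefferman's (C) through `navierStokesBreakdownR3_of_witness`.

References: T. Tao, J. Amer. Math. Soc. 29 (2016) 601–674, §1.3 (the fluid-computer programme:
gadgets, one-shot energy transfer, the clock) [cite: Tao2016AveragedNS, §1.3]; C. L. Fefferman,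
Clay problem description, (C) (4)–(7) [cite: FeffermanClay2006, (C)]; T. Tao, Anal. PDE 6 (2013),
Cor. 11.4 [cite: Tao2011, Cor. 11.4]; J. Leray, Acta Math. 63 (1934) §20 (similarity)
[cite: Leray1934, §20].
-/

noncomputable section

namespace Summit.NavierStokesRegularity.FluidComputer.TriggeredTransfer

open Set MeasureTheory Function
open scoped ENNReal ContDiff NNReal
open Literature.Analysis.FluidPDE
open Literature.Analysis.FluidPDE.FluidComputer (E3 Vel)

/-- **A one-shot triggered-transfer scheme at unit scale** (door N1-FC). Data: the scale ratio
`lam = λ > 1` between parent and child, the efficiency floor `eta = η` with the Kelvin-critical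
inequality `1 < η λ` (FC-AUDIT floor, one child) and `η ≤ 1`, the threshold amplitude `UStar`, the
designed family `F U` of unit-scale level states of amplitude `U`, the nest radius `R`, the
speed-floor constant `c`, the child-centre displacement bound `D`, the trigger shape constants
`A i` (bound on the `i`-th space–time derivative per unit amplitude), the e-fold budget `a` per unit
Reynolds number, and the transfer-time law `C_τ (1 + |log ε|)^q / U`. Axioms (all STATIC): signs;
every member of every `F U`, `U ≥ U⋆`, is a Clay datum (smooth, divergence free, rapidly decaying —
(A)(4)); every member has speed at least `c U` somewhere in the closed nest ball; some `F U₀`,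
`U₀ ≥ U⋆`, is inhabited (the ignition state, which a Clay-class one-shot preparation must reach —
outside this type). The DYNAMICS is the separate predicate `TriggerScheme.Transfers`; nothing here
asserts it. A TYPE; no instance is claimed. [cite: Tao2016AveragedNS, §1.3] -/
structure TriggerScheme where
  /-- scale ratio `λ` between consecutive levels -/
  lam : ℝ
  /-- efficiency floor `η`: child energy / parent energy -/
  eta : ℝ
  /-- threshold amplitude (level Reynolds number at unit viscosity) -/
  UStar : ℝ
  /-- the designed family of unit-scale level states, indexed by the amplitude `U` -/
  F : ℝ → Set Vel
  /-- radius of the closed nest ball (speed floor inside, triggers supported inside) -/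
  R : ℝ
  /-- speed-floor constant -/
  c : ℝ
  /-- bound on the displacement of the child's centre (unit scale) -/
  D : ℝ
  /-- trigger shape constants: `‖Dⁱ g‖ ≤ ε * A i` -/
  A : ℕ → ℝ
  /-- e-fold budget per unit Reynolds number: `ε` is admissible iff `ν |log ε| ≤ a U` -/
  a : ℝ
  /-- transfer-time constant (turnover units) -/
  Cτ : ℝ
  /-- poly-logarithmic exponent of the transfer-time law -/
  q : ℕ
  one_lt_lam : 1 < lam
  /-- the Kelvin-critical (FC-AUDIT) floor `η > 1/λ`, i.e. the level Reynolds numbers climb -/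
  kelvin : 1 < eta * lam
  eta_le_one : eta ≤ 1
  UStar_pos : 0 < UStar
  R_pos : 0 < R
  c_pos : 0 < c
  D_nonneg : 0 ≤ D
  A_nonneg : ∀ i, 0 ≤ A i
  a_pos : 0 < a
  Cτ_pos : 0 < Cτ
  /-- every level state is a Clay datum: (A)(4) -/
  clay : ∀ U, UStar ≤ U → ∀ w ∈ F U, ContDiff ℝ ∞ w ∧ NSWave0.IsDivFree w ∧ HasRapidSpatialDecay w
  /-- speed floor: a level state of amplitude `U` has speed `≥ c U` somewhere in the nest ball -/
  floor : ∀ U, UStar ≤ U → ∀ w ∈ F U, ∃ x : E3, ‖x‖ ≤ R ∧ c * U ≤ ‖w x‖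
  /-- the ignition level is inhabited -/
  seed : ∃ U, UStar ≤ U ∧ (F U).Nonempty

namespace TriggerScheme

variable (𝒮 : TriggerScheme)

/-- The amplitude growth factor per level `(η λ)^{1/2}` (`Re_{k+1} = (ηλ)^{1/2} Re_k`). [folklore] -/
def growth : ℝ := Real.sqrt (𝒮.eta * 𝒮.lam)

/-- The Kelvin floor `1 < ηλ` is exactly `1 < (ηλ)^{1/2}`: amplitudes (level Reynolds numbers)
climb geometrically along the scheme. [folklore] -/
theorem one_lt_growth : 1 < 𝒮.growth := by
  unfold growth
  calc (1 : ℝ) = Real.sqrt 1 := Real.sqrt_one.symm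
    _ < Real.sqrt (𝒮.eta * 𝒮.lam) := Real.sqrt_lt_sqrt zero_le_one 𝒮.kelvin

/-- The scale ratio is positive. [folklore] -/
theorem lam_pos : 0 < 𝒮.lam := zero_lt_one.trans 𝒮.one_lt_lam

/-- **An admissible trigger of amplitude `ε` for the window `[0, T]`** (the Clay-class seed the
force plants): a force field `g`, smooth on all of `ℝ × ℝ³`, identically zero for `t ≤ δ` (the piece
starts unforced — this is the overlap with the previous level) and for `t ≥ T` (unforced from the
hand-over on), zero outside the closed nest ball, with every space–time derivative bounded by
`ε * A i`. [cite: FeffermanClay2006, (C) (5)] -/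
structure IsTrigger (ε δ T : ℝ) (g : ℝ → Vel) : Prop where
  smooth : ContDiff ℝ ∞ (uncurry g)
  off_early : ∀ t, t ≤ δ → g t = 0
  off_late : ∀ t, T ≤ t → g t = 0
  off_far : ∀ (t : ℝ) (x : E3), 𝒮.R ≤ ‖x‖ → g t x = 0
  small : ∀ (i : ℕ) (z : ℝ × E3), ‖iteratedFDeriv ℝ i (uncurry g) z‖ ≤ ε * 𝒮.A i

/-- **One triggered transfer** at viscosity `ν`, from the unit-scale level state `w` of amplitude
`U`, with trigger amplitude `ε`: there are a hand-over time `T ≤ C_τ (1 + |log ε|)^q / U`, a margin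
`δ` (`0 < δ`, `2δ < T`), an admissible trigger `g`, and an EXACT classical solution `(u, p)` of the
system forced by `g` on `[0, T + δ]` with `u 0 = w` and finite energy on the slab, whose hand-over
state is exactly a `λ`-zoomed member of the family one amplitude level up:
`u T = (x ↦ λ • w' (λ • (x - x₀)))` with `w' ∈ F U'`, `U' ≥ (ηλ)^{1/2} U`, `‖x₀‖ ≤ D`. LOCAL in
time and EXISTENTIAL in the solution (no quantifier over global solutions — compare the one-shot
degeneracy of `FluidComputer.GadgetLibrary.step`, `FluidComputerGadgetOneShot`). [cite: Tao2016AveragedNS, §1.3] -/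
def Step (ν U ε : ℝ) (w : Vel) : Prop :=
  ∃ (T δ : ℝ) (g : ℝ → Vel) (u : ℝ → Vel) (p : ℝ → E3 → ℝ),
    0 < δ ∧ 2 * δ < T ∧ T ≤ 𝒮.Cτ * (1 + |Real.log ε|) ^ 𝒮.q / U ∧
    𝒮.IsTrigger ε δ T g ∧
    IsClassicalNSSolutionOn (Icc 0 (T + δ)) ν g u p ∧ u 0 = w ∧
    (∃ C : ℝ≥0∞, C < ⊤ ∧ ∀ t ∈ Icc 0 (T + δ), ∫⁻ x, ‖u t x‖ₑ ^ 2 ≤ C) ∧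
    ∃ (U' : ℝ) (w' : Vel) (x₀ : E3), 𝒮.growth * U ≤ U' ∧ w' ∈ 𝒮.F U' ∧ ‖x₀‖ ≤ 𝒮.D ∧
      u T = fun x => 𝒮.lam • w' (𝒮.lam • (x - x₀))

/-- **The scheme transfers at viscosity `ν`** («η > 1/λ uniformly in Re»): from EVERY member of
the family at EVERY amplitude `U ≥ U⋆`, for EVERY admissible trigger amplitude — `0 < ε ≤ 1` with
`ν |log ε| ≤ a U` (the e-folds the instability needs fit in the viscous lifetime; at `ν = 0` every
`ε ∈ (0, 1]` is admissible) — one triggered transfer is available. The physics of door N1-FC;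
open, never asserted in the tree. [cite: Tao2016AveragedNS, §1.3] -/
def Transfers (ν : ℝ) : Prop :=
  ∀ U, 𝒮.UStar ≤ U → ∀ w ∈ 𝒮.F U, ∀ ε : ℝ, 0 < ε → ε ≤ 1 → ν * |Real.log ε| ≤ 𝒮.a * U →
    𝒮.Step ν U ε w

end TriggerScheme

end Summit.NavierStokesRegularity.FluidComputer.TriggeredTransfer

end
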